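import Summits.CriticalPhenomena.PercolationContinuityZ3.Theorems.Transplant.BoxProdZ2KitStepIV
import HarnessLib

/-!
# The per-level KIT CLAUSE of `KNLevels.TargetProperty` for the tube levels of `X □ ℤ²` (Steps III–IV data of Kozma–Nitzan's Lemma 10,
# product version), assembled from the thick-seed kit (BLUEPRINT-I-PHI §1 rows "Lemma 10, Steps III–IV")

builds on p205010 (kernel theorem, internal audit signed; external expert review pending) — nothing in this file uses p205010.
Lane `prim-bschramm`, seat `prim-bschramm-p3` (Φ3-prod wiring, packaged for the caller of `TargetProperty (tubeGraph X π) (Δ+4) p` —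
Lemmas 11/12-prod); helper file (`--supports stmt-CriticalPhenomena-4575 --as helper`).

`KNLevels.TargetProperty G Δ p` (stmt, `KNLevelsHGluing`) asks, for every level `j` of the window, for seed data `σ` and a pinning set `S`
with `SHyp L j σ`, `σ.N ≤ N`, `(1 - p^{σ.sB})^{σ.k} ≤ δ`, `S ⊆ X_j ∩ D`, seeds off `S`, faces in `S`, and the Step-IV estimate `hIV(x)` at
every candidate contact `x ∈ σ.K`.  **`kitClause`** delivers this for the tube level data `tubeLData X π lo hi o Sfin` with
`σ = kitSData (nF := ψ M)` and `S =` the shell `π × (Icc (Lo+1) (Hi-1) \ Icc (Lo+2M+2) (Hi-2M-2))`, from: the standard estimates at `δ²`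
(`exists_scales`), the bookkeeping `k · kitB ≤ N`, `(1 - p^{kitSB})^k ≤ δ`, `ψ M ≤ Rw`, a wide level, `X_j ⊆ D`, a subbox weighting of the
tube graph on `D`, and — the caller's only geometric duty — for every candidate contact EITHER a vertex of its thick face in the target `T`
(edge contacts, `hIV_of_mem_face`) OR a frame `γ` with a target route `h3` (deep contacts, `kit_hIV`).

[cite: KozmaNitzan2024, §4 Lemma 10, Steps III–IV (pp. 19–21) — the ℤ^d model]
-/

noncomputable section

open MeasureTheory

namespace Summit.CriticalPhenomena.PercolationContinuityZ3.Theorems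

namespace Transplant

namespace BoxProdZ2

open Literature.Probability.Percolation Literature.Probability.LatticeModels SimpleGraph KNLevels KozmaNitzan
open Literature.Probability.Percolation.GM

variable {W : Type} [DecidableEq W] (X : SimpleGraph W) [X.LocallyFinite]

omit [DecidableEq W] [X.LocallyFinite] in
/-- The shell lies in the level: `Icc (Lo+1) (Hi-1) \ … ⊆ Icc Lo Hi`. [folklore] -/
theorem shell_subset_tubeLevel (π : Finset W) (lo hi : Site 2) (j M : ℕ) :
    π ×ˢ (Finset.Icc ((lo - ((j : ℕ) : Site 2)) + 1) ((hi + ((j : ℕ) : Site 2)) - 1) \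
      Finset.Icc ((lo - ((j : ℕ) : Site 2)) + ((2 * M + 2 : ℕ) : Site 2)) ((hi + ((j : ℕ) : Site 2)) - ((2 * M + 2 : ℕ) : Site 2))) ⊆
      tubeLevel π lo hi j := by
  intro u hu
  rw [Finset.mem_product, Finset.mem_sdiff, mem_Icc_iff] at hu
  rw [mem_tubeLevel_iff, mem_Icc_iff]
  refine ⟨hu.1, fun i => ?_⟩
  have h := hu.2.1 i
  simp only [Pi.add_apply, Pi.sub_apply, Pi.natCast_apply, Pi.one_apply] at h ⊢
  constructor <;> omega

/-- **The kit clause of `TargetProperty` for a tube level of `X □ ℤ²`.**  [cite: KozmaNitzan2024, §4 Lemma 10, Steps III–IV (pp. 19–21)] -/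
theorem kitClause [Countable W] {Δ : ℕ} (hΔ : ∀ w, X.degree w ≤ Δ) {p : unitInterval} (hT : TubeSubcritical X p) (V₀ : Finset W)
    {δ : ℝ} (hδ : 0 < δ) {msel : W → ℕ} {M : ℕ} (hmsel : ∀ τ ∈ V₀, msel τ ≤ M)
    (hstd : ∀ τ ∈ V₀,
      1 - δ ^ 2 < (bondPercolation (X □ zdGraph 2) p).real (UniqZone.zone (X □ zdGraph 2) (ufatSeq X hT V₀ τ) (msel τ) M) ∧
      ∀ g : HOct 2, 1 - δ ^ 2 < (bondPercolation (X □ zdGraph 2) p).real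
        (linkIn (↑(ufatSeq X hT V₀ τ M)) (ufatSeq X hT V₀ τ (msel τ)) (ballFin X τ (ufatRadius X hT V₀ M) ×ˢ piece g M)))
    {xe : W} {Rw : ℕ} (hnF : ufatRadius X hT V₀ M ≤ Rw) {lo hi : Site 2} {j : ℕ}
    (hwide : ∀ k, (lo - ((j : ℕ) : Site 2)) k + 2 * M + 2 ≤ (hi + ((j : ℕ) : Site 2)) k) (k : ℕ) (o : W × Site 2)
    (Sfin : Finset (W × Site 2)) {Wt : Sym2 (W × Site 2) → unitInterval} {D T : Finset (W × Site 2)}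
    (hWD : IsSubbox (tubeGraph X (ballFin X xe Rw)) Wt p D) (hXD : tubeLevel (ballFin X xe Rw) lo hi j ⊆ D) {N : ℕ}
    (hN : k * kitB Δ M (ufatRadius X hT V₀ M) ≤ N) (hk : (1 - (p : ℝ) ^ kitSB Δ M (ufatRadius X hT V₀ M)) ^ k ≤ δ)
    (hcon : ∀ x ∈ outerBoundary (tubeGraph X (ballFin X xe Rw)) (tubeLevel (ballFin X xe Rw) lo hi j),
      (∃ u ∈ kitFace X xe Rw (lo - ((j : ℕ) : Site 2)) (hi + ((j : ℕ) : Site 2)) M (ufatRadius X hT V₀ M) x, u ∈ T) ∨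
      ∃ (γ : X ≃g X) (Qt Ft : Finset (W × Site 2)), γ (fibCtrT X xe Rw (ufatRadius X hT V₀ M) x.1) ∈ V₀ ∧ Ft ⊆ T ∧ Qt ⊆ D ∧
        Disjoint Ft (kitCube X xe Rw (lo - ((j : ℕ) : Site 2)) (hi + ((j : ℕ) : Site 2)) M (ufatRadius X hT V₀ M) x) ∧
        1 - δ ^ 2 < (prodBernoulli Wt).real (linkIn (↑Qt)
          (frameSeq X hT V₀ γ (vctr (lo - ((j : ℕ) : Site 2)) (hi + ((j : ℕ) : Site 2)) M
            (pwin (lo - ((j : ℕ) : Site 2)) (hi + ((j : ℕ) : Site 2)) M x.2).1 (pwin (lo - ((j : ℕ) : Site 2)) (hi + ((j : ℕ) : Site 2)) M x.2).2.1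
            (pwin (lo - ((j : ℕ) : Site 2)) (hi + ((j : ℕ) : Site 2)) M x.2).2.2) (γ (fibCtrT X xe Rw (ufatRadius X hT V₀ M) x.1))
            (msel (γ (fibCtrT X xe Rw (ufatRadius X hT V₀ M) x.1)))) Ft)) :
    ∃ (σ : SData (W × Site 2)) (S : Finset (W × Site 2)), SHyp (tubeLData X (ballFin X xe Rw) lo hi o Sfin) j σ ∧ σ.N ≤ N ∧
      (1 - (p : ℝ) ^ σ.sB) ^ σ.k ≤ δ ∧ S ⊆ (tubeLData X (ballFin X xe Rw) lo hi o Sfin).X j ∧ S ⊆ D ∧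
      (∀ x ∈ σ.K, ∀ e ∈ σ.seed x, e ∉ wireSet (↑S : Set (W × Site 2))) ∧ (∀ x ∈ σ.K, σ.face x ⊆ S) ∧
      (∀ x ∈ σ.K, 1 - 3 * δ ≤ (prodBernoulli Wt).real {ω | ∃ u ∈ σ.face x,
        1 - δ < (prodBernoulli (pinW Wt (wireSet (↑S : Set (W × Site 2))) ω)).real (⋃ t ∈ T, openConnIn (↑D : Set (W × Site 2)) u t)}) := by
  set S : Finset (W × Site 2) := (ballFin X xe Rw) ×ˢ (Finset.Icc ((lo - ((j : ℕ) : Site 2)) + 1) ((hi + ((j : ℕ) : Site 2)) - 1) \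
    Finset.Icc ((lo - ((j : ℕ) : Site 2)) + ((2 * M + 2 : ℕ) : Site 2)) ((hi + ((j : ℕ) : Site 2)) - ((2 * M + 2 : ℕ) : Site 2))) with hS
  have hSX : S ⊆ tubeLevel (ballFin X xe Rw) lo hi j := shell_subset_tubeLevel _ lo hi j M
  have hSD : S ⊆ D := hSX.trans hXD
  have hface : ∀ x ∈ outerBoundary (tubeGraph X (ballFin X xe Rw)) (tubeLevel (ballFin X xe Rw) lo hi j),
      kitFace X xe Rw (lo - ((j : ℕ) : Site 2)) (hi + ((j : ℕ) : Site 2)) M (ufatRadius X hT V₀ M) x ⊆ S :=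
    fun x hx => (kitFace_subset_kitCube (X := X) hwide hx).trans (kitCube_subset_shell (X := X) hwide hnF hx)
  refine ⟨kitSData X hΔ xe Rw lo hi j M (ufatRadius X hT V₀ M) k, S, shyp_kit (X := X) hΔ hwide hnF k o Sfin, hN, hk, hSX, hSD,
    fun x hx e he => ?_, fun x hx => hface x hx, fun x hx => ?_⟩
  · -- seeds avoid the pairs inside the shell
    rw [kitSData_K] at hx
    exact kitSeed_notMem_wireSet (X := X) hwide hx (π' := ballFin X xe Rw) (fun t ht => (Finset.mem_sdiff.1 ht).1) he
  · -- Step IV: edge contacts by the face-in-target shortcut, deep contacts by `kit_hIV`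
    rw [kitSData_K] at hx
    rcases hcon x hx with ⟨u, hu, huT⟩ | ⟨γ, Qt, Ft, hγ, hFt, hQt, hfar, h3⟩
    · exact hIV_of_mem_face hδ hu huT (hSD (hface x hx hu))
    · exact kit_hIV X hT V₀ hδ hmsel hstd hnF hwide hWD hSD hx γ hγ hFt hQt hfar h3

end BoxProdZ2

end Transplant

end Summit.CriticalPhenomena.PercolationContinuityZ3.Theorems

end
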